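/-
Copyright (c) 2026. All rights reserved.
Released under Apache 2.0 license as described in the file LICENSE.
Authors: abc-iut cell, campaign-S prover seat abc-iut-S1 (gen 2).
-/
import Mathlib.Algebra.Algebra.Pi
import Literature.LinearAlgebra.BaseChange.PiTensorRestrictScalars
import HarnessLib

/-!
# The distributed restriction-of-scalars map is multiplicative on tensor products of algebras

Topic `LinearAlgebra/BaseChange`; namespace `Literature.LinearAlgebra.BaseChange`; THEOREMS ONLY
(companion of `PiTensorRestrictScalars.lean`).

For commutative `S`-algebras `A_{a,v}` over an `R`-algebra `S`, the packets `⨂_{a,R} (Π_v A_{a,v})` and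
`⨂_{a,S} A_{a,v⃗ a}` are commutative (semi)rings (Mathlib `PiTensorProduct.instCommSemiring`:
`⊗x · ⊗y = ⊗(xy)`), and the distributed comparison map
`e = piTensorDistrib R S A : ⨂_{a,R} (Π_v A_{a,v}) → Π_{v⃗} ⨂_{a,S} A_{a,v⃗ a}` of `PiTensorRestrictScalars.lean`
is a RING homomorphism: `piTensorDistrib_map_one`, `piTensorDistrib_map_mul` (bilinearity reduces it to pure
tensors, `piTensorDistrib_tprod_mul_tprod`).  Consumers wanting the bundled `R`-algebra map write
`AlgHom.ofLinearMap (piTensorDistrib R S A) (piTensorDistrib_map_one R S A) (piTensorDistrib_map_mul R S A)`.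
(The single-packet map `θ` is already bundled: `piTensorRestrictScalarsAlgHom`.)

Source: N. Bourbaki, *Algebra I*, Ch. II §3 no. 7, canonical map (22) of "tensor products of products",
combined with Ch. III §4 no. 1 (tensor product of algebras: the multiplication `(⊗x)(⊗y) = ⊗(xy)`); here in
`n`-fold form followed by the change of ring of Ch. II §3 no. 3 Prop. 2. Motivation (no dependence): the
HOLOMORPHIC tensor packets of [IUTchIII] Prop. 3.1 (i) carry ring structures, through which the splitting
monoids of Prop. 3.4 (ii) / Thm. 3.11 (i)(b) act by multiplication; so the comparison to the completed
packets must be multiplicative.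
-/

noncomputable section

open PiTensorProduct Function
open scoped TensorProduct

namespace Literature.LinearAlgebra.BaseChange

universe uR uS uα uV uM

variable (R : Type uR) (S : Type uS) [CommSemiring R] [CommSemiring S] [Algebra R S]
variable {α : Type uα} {V : Type uV}
variable (A : α → V → Type uM) [∀ a v, CommSemiring (A a v)] [∀ a v, Algebra S (A a v)]
  [∀ a v, Algebra R (A a v)] [∀ a v, IsScalarTower R S (A a v)]

/-- `e 1 = 1` (`1 = ⊗_a 1`, and every component of `e (⊗ 1)` is `⊗_S 1 = 1`).
[cite: BourbakiAlgebraI1989, Ch. II §3 no. 7 (22)] -/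
theorem piTensorDistrib_map_one :
    piTensorDistrib R S (fun a v ↦ A a v) 1 = 1 := by
  funext vA
  rw [PiTensorProduct.one_def, piTensorDistrib_tprod, Pi.one_apply, PiTensorProduct.one_def]
  rfl

/-- On pure tensors `e` is multiplicative: `e (⊗x · ⊗y) = e (⊗x) · e (⊗y)` (componentwise
`⊗_S x_a(v⃗ a) · ⊗_S y_a(v⃗ a) = ⊗_S (x·y)_a(v⃗ a)`). [cite: BourbakiAlgebraI1989, Ch. II §3 no. 7 (22)] -/
theorem piTensorDistrib_tprod_mul_tprod (x y : ∀ a, ∀ v, A a v) :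
    piTensorDistrib R S (fun a v ↦ A a v) (tprod R x * tprod R y) =
      piTensorDistrib R S (fun a v ↦ A a v) (tprod R x) *
        piTensorDistrib R S (fun a v ↦ A a v) (tprod R y) := by
  funext vA
  rw [PiTensorProduct.tprod_mul_tprod, Pi.mul_apply, piTensorDistrib_tprod, piTensorDistrib_tprod,
    piTensorDistrib_tprod, PiTensorProduct.tprod_mul_tprod]
  rfl

/-- **`e` is multiplicative**: `e (x · y) = e x · e y` for all `x, y ∈ ⨂_{a,R} (Π_v A_{a,v})` (bilinearity
reduces it to pure tensors). Hence `e` is a homomorphism of (semi)rings and — with `piTensorDistrib_map_one` —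
of `R`-algebras. [cite: BourbakiAlgebraI1989, Ch. II §3 no. 7 (22)] -/
theorem piTensorDistrib_map_mul (x y : ⨂[R] a, (∀ v, A a v)) :
    piTensorDistrib R S (fun a v ↦ A a v) (x * y) =
      piTensorDistrib R S (fun a v ↦ A a v) x * piTensorDistrib R S (fun a v ↦ A a v) y := by
  -- the `R`-algebra compatibility instances on the packets are not found by instance search through the
  -- `PiTensorProduct.hasSMul'` action (cf. Mathlib `PiTensorProduct.instCommSemiring`); supply them.
  letI : IsScalarTower R (⨂[R] a, (∀ v, A a v)) (⨂[R] a, (∀ v, A a v)) :=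
    IsScalarTower.right (R := R) (A := ⨂[R] a, (∀ v, A a v))
  letI : SMulCommClass R (⨂[R] a, (∀ v, A a v)) (⨂[R] a, (∀ v, A a v)) :=
    Algebra.to_smulCommClass (R := R) (A := ⨂[R] a, (∀ v, A a v))
  haveI : ∀ vA : α → V, IsScalarTower R (⨂[S] a, A a (vA a)) (⨂[S] a, A a (vA a)) :=
    fun vA ↦ IsScalarTower.right (R := R) (A := ⨂[S] a, A a (vA a))
  haveI : ∀ vA : α → V, SMulCommClass R (⨂[S] a, A a (vA a)) (⨂[S] a, A a (vA a)) :=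
    fun vA ↦ Algebra.to_smulCommClass (R := R) (A := ⨂[S] a, A a (vA a))
  induction x using PiTensorProduct.induction_on generalizing y with
  | smul_tprod r f =>
    induction y using PiTensorProduct.induction_on with
    | smul_tprod s g =>
      rw [smul_mul_assoc, mul_smul_comm, map_smul, map_smul, map_smul, map_smul,
        piTensorDistrib_tprod_mul_tprod, smul_mul_assoc, mul_smul_comm]
    | add y₁ y₂ h₁ h₂ => rw [mul_add, map_add, map_add, mul_add, h₁, h₂]
  | add x₁ x₂ h₁ h₂ => rw [add_mul, map_add, map_add, add_mul, h₁ y, h₂ y]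

/-- `e` preserves powers. [cite: BourbakiAlgebraI1989, Ch. II §3 no. 7 (22)] -/
theorem piTensorDistrib_map_pow (x : ⨂[R] a, (∀ v, A a v)) (n : ℕ) :
    piTensorDistrib R S (fun a v ↦ A a v) (x ^ n) = piTensorDistrib R S (fun a v ↦ A a v) x ^ n := by
  induction n with
  | zero => rw [pow_zero, pow_zero, piTensorDistrib_map_one]
  | succ n ih => rw [pow_succ, pow_succ, piTensorDistrib_map_mul, ih]

end Literature.LinearAlgebra.BaseChange

end
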